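import Literature.Computability.Cryptography.HILLAtoms
import Mathlib.Analysis.Convex.SpecificFunctions.Basic
import Mathlib.Analysis.Convex.Jensen
import HarnessLib

/-!
# The real entropy of HILL's false-entropy generator (Håstad–Impagliazzo–Levin–Luby 1999, §6.3 Lemma 6.3.1 / §7)

> "As noted above, the conditional entropy of `𝒳` given `f'(𝒳)` and `b(𝒳, Y)` is at least
> `cₙ − eₙ − pₙ + 1/(2n)`" [HILL 1999, §7, proof of Thm 7.0.5, with Lemma 6.3.1: the bit `b` is "almost
> totally predictable for almost all inputs where `I ≥ D̃_f(f(X))`"].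

This file proves the entropy accounting behind this sentence, for the tree's `f'(w, r) = g f (w ‖ r)` of
`HILLHashedFunction` and its `K = ⌊log₂ N⌋` Goldreich–Levin bits `glBits K N w σ` (in place of the single bit `b`):

* `mapEntropy_le_logb_card_image` — Shannon entropy is at most `log₂` of the support size (Jensen);
* `condEntropy_ge` (generic) — for a source `fval : Ω₀ → β` and any `K`-bit labelling `lab w σ`,
  `H(W | fval(W), σ, lab(W, σ)) ≥ (log₂|Ω₀| − H(fval)) − K · Pr[fval⁻¹(fval W) ≠ {W}]`: on a singleton fibre the
  label costs nothing, on the others at most `K` bits (Jensen per fibre);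
* `card_notDet_le` — for `f'`: `Pr[(w, r) is not determined by f'(w, r)] ≤ Pr[⟦ι⟧ < D̃_f(f x)] + 2^{1−eLen N}`
  (a sibling `x' ≠ x` must collide with `x` on the first `⟦ι⟧ + eLen N` hash bits; pairwise independence of
  the affine family, `isPairwiseIndep_hashV`, and the union bound over `< 2^{D̃+1}` siblings), and
  `card_iOf_lt_Dtil` — `Pr[⟦ι⟧ < D̃] = Pr[𝒯₀] − 2^{−b(N)}`.

No new named facts.
-/

namespace Literature.Computability.Cryptography

open Finset Real

namespace HILL

namespace Ent

/-! ### Entropy is at most `log₂` of the support (Jensen) -/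

variable {ι β : Type*} [DecidableEq β]

/-- **`H(f(U_S)) ≤ log₂ |f(S)|`.** [cite: CoverThomas2006, Thm. 2.6.4] -/
theorem mapEntropy_le_logb_card_image {S : Finset ι} (hS : S.Nonempty) (f : ι → β) :
    mapEntropy S f ≤ Real.logb 2 (S.image f).card := by
  classical
  have hSpos : (0 : ℝ) < S.card := by exact_mod_cast hS.card_pos
  rw [mapEntropy_eq_sum_image]
  -- weights `p_y = |fibre| / |S|`, points `|S| / |fibre|`
  set T := S.image f with hT
  set wgt : β → ℝ := fun y => ((fiber S f y).card : ℝ) / S.card with hwgt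
  set pt : β → ℝ := fun y => (S.card : ℝ) / (fiber S f y).card with hpt
  have hfibpos : ∀ y ∈ T, (0 : ℝ) < (fiber S f y).card := fun y hy => by
    obtain ⟨v, hv, rfl⟩ := Finset.mem_image.1 hy
    exact_mod_cast card_fiber_pos f hv
  have h0 : ∀ y ∈ T, 0 ≤ wgt y := fun y _ => by positivity
  have h1 : ∑ y ∈ T, wgt y = 1 := by
    rw [hwgt]; simp only
    rw [← Finset.sum_div, div_eq_one_iff_eq hSpos.ne']
    have := Finset.card_eq_sum_card_fiberwise (f := f) (s := S) (t := T) (fun v hv => Finset.mem_image_of_mem f hv)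
    rw [this]; push_cast
    refine Finset.sum_congr rfl fun y _ => ?_
    simp [fiber]
  have hmem : ∀ y ∈ T, pt y ∈ Set.Ioi (0 : ℝ) := fun y hy => by
    show 0 < pt y; rw [hpt]; exact div_pos hSpos (hfibpos y hy)
  have hJ := (strictConcaveOn_log_Ioi.concaveOn).le_map_sum h0 h1 hmem
  have hsum : ∑ y ∈ T, wgt y • pt y = (T.card : ℝ) := by
    rw [show (T.card : ℝ) = ∑ y ∈ T, (1 : ℝ) by simp]
    refine Finset.sum_congr rfl fun y hy => ?_
    rw [smul_eq_mul, hwgt, hpt]; simp only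
    field_simp [(hfibpos y hy).ne']
  rw [hsum] at hJ
  have hlog2 : (0 : ℝ) < Real.log 2 := Real.log_pos one_lt_two
  calc ∑ y ∈ T, ((fiber S f y).card : ℝ) / S.card * Real.logb 2 ((S.card : ℝ) / (fiber S f y).card)
      = (∑ y ∈ T, wgt y • Real.log (pt y)) / Real.log 2 := by
        rw [Finset.sum_div]
        refine Finset.sum_congr rfl fun y _ => ?_
        rw [smul_eq_mul, Real.logb, hwgt, hpt]; simp only; ring
    _ ≤ Real.log T.card / Real.log 2 := div_le_div_of_nonneg_right hJ hlog2.le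
    _ = Real.logb 2 T.card := by rw [Real.logb]

/-- The sum form: `Σ_{v ∈ S} log₂ |fibre through v| ≥ |S| (log₂|S| − log₂ |f(S)|)`. [folklore] -/
theorem sum_logb_card_fiber_ge {S : Finset ι} (hS : S.Nonempty) (f : ι → β) :
    (S.card : ℝ) * (Real.logb 2 S.card - Real.logb 2 (S.image f).card) ≤ ∑ v ∈ S, Real.logb 2 ((fiber S f (f v)).card : ℝ) := by
  have hSpos : (0 : ℝ) < S.card := by exact_mod_cast hS.card_pos
  have h := mapEntropy_le_logb_card_image hS f
  unfold mapEntropy at h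
  rw [div_le_iff₀ hSpos] at h
  have hsplit : ∑ v ∈ S, Real.logb 2 ((S.card : ℝ) / (fiber S f (f v)).card) = ∑ v ∈ S, (Real.logb 2 S.card - Real.logb 2 ((fiber S f (f v)).card : ℝ)) := by
    refine Finset.sum_congr rfl fun v hv => ?_
    rw [Real.logb_div hSpos.ne' (by exact_mod_cast (card_fiber_pos f hv).ne')]
  rw [hsplit, Finset.sum_sub_distrib, Finset.sum_const, nsmul_eq_mul] at h
  linarith

/-! ### Conditional entropy given the value and a short label -/

section CondEnt

variable {Ω₀ Sg γ : Type*} [Fintype Ω₀] [DecidableEq Ω₀] [Fintype Sg] [DecidableEq Sg] [DecidableEq γ]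

/-- **The fibre of `fval` through `ω` is a singleton** (`ω` is determined by its value). [folklore] -/
def Det (fval : Ω₀ → β) (ω : Ω₀) : Prop := (fiber Finset.univ fval (fval ω)).card = 1

/-- `Det` is decidable (an equality of naturals). [folklore] -/
instance (fval : Ω₀ → β) : DecidablePred (Det fval) := fun _ => Nat.decEq _ _

/-- The entropy of an injective map is `log₂` of the domain. [folklore] -/
theorem mapEntropy_of_injective {Ω α : Type*} [Fintype Ω] [DecidableEq α] {h : Ω → α} (hinj : Function.Injective h) :
    mapEntropy Finset.univ h = Real.logb 2 (Fintype.card Ω) := by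
  classical
  unfold mapEntropy
  have hfib : ∀ v : Ω, (fiber Finset.univ h (h v)).card = 1 := fun v => by
    rw [Finset.card_eq_one]
    refine ⟨v, ?_⟩
    ext w
    simp only [fiber, Finset.mem_filter, Finset.mem_univ, true_and, Finset.mem_singleton]
    exact ⟨fun e => hinj e, fun e => by rw [e]⟩
  simp only [hfib, Nat.cast_one, div_one, Finset.sum_const, Finset.card_univ, nsmul_eq_mul]
  rcases Nat.eq_zero_or_pos (Fintype.card Ω) with h0 | hpos
  · simp [h0]
  · field_simp

/-- `Σ_v log₂ |fibre through v| = |S| (log₂ |S| − H)`. [folklore] -/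
theorem sum_logb_card_fiber_eq {S : Finset ι} (hS : S.Nonempty) (f : ι → β) :
    ∑ v ∈ S, Real.logb 2 ((fiber S f (f v)).card : ℝ) = S.card * (Real.logb 2 S.card - mapEntropy S f) := by
  have hSpos : (0 : ℝ) < S.card := by exact_mod_cast hS.card_pos
  unfold mapEntropy
  have hsplit : ∑ v ∈ S, Real.logb 2 ((S.card : ℝ) / (fiber S f (f v)).card) = ∑ v ∈ S, (Real.logb 2 S.card - Real.logb 2 ((fiber S f (f v)).card : ℝ)) := by
    refine Finset.sum_congr rfl fun v hv => ?_
    rw [Real.logb_div hSpos.ne' (by exact_mod_cast (card_fiber_pos f hv).ne')]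
  rw [hsplit, Finset.sum_sub_distrib, Finset.sum_const, nsmul_eq_mul]
  field_simp
  ring

omit [Fintype Ω₀] [DecidableEq Ω₀] in
/-- **On one fibre the label costs at most `K` bits, and nothing on a singleton fibre.** [folklore] -/
theorem sum_logb_class_ge (F : Finset Ω₀) (hF : F.Nonempty) (ℓ : Ω₀ → γ) (K : ℕ) (hγ : (F.image ℓ).card ≤ 2 ^ K) :
    (F.card : ℝ) * Real.logb 2 F.card - K * (if F.card = 1 then 0 else (F.card : ℝ)) ≤ ∑ ω ∈ F, Real.logb 2 ((fiber F ℓ (ℓ ω)).card : ℝ) := by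
  have h := sum_logb_card_fiber_ge hF ℓ
  have himg_pos : 0 < (F.image ℓ).card := Finset.card_pos.2 (hF.image ℓ)
  have hlog : Real.logb 2 (F.image ℓ).card ≤ K := by
    calc Real.logb 2 (F.image ℓ).card ≤ Real.logb 2 ((2 : ℝ) ^ K) :=
          Real.logb_le_logb_of_le one_lt_two (by exact_mod_cast himg_pos) (by exact_mod_cast hγ)
      _ = K := by rw [Real.logb_pow, Real.logb_self_eq_one one_lt_two]; ring
  split_ifs with h1
  · -- singleton fibre: the label is constant on it
    rw [h1] at h ⊢
    have : (F.image ℓ).card = 1 := le_antisymm (by rw [← h1]; exact Finset.card_image_le) himg_pos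
    rw [this] at h
    simpa using h
  · have hFc : (0 : ℝ) ≤ F.card := Nat.cast_nonneg _
    nlinarith [mul_le_mul_of_nonneg_left hlog hFc]

omit [DecidableEq Ω₀] in
/-- The `y`-fibre over the product is the labelled class inside the value fibre. [folklore] -/
theorem card_fiber_prod_eq (fval : Ω₀ → β) (lab : Ω₀ → Sg → γ) (ω : Ω₀) (σ : Sg) :
    (fiber (Finset.univ : Finset (Ω₀ × Sg)) (fun v => (fval v.1, v.2, lab v.1 v.2)) (fval ω, σ, lab ω σ)).card =
      (fiber (fiber Finset.univ fval (fval ω)) (fun ω' => lab ω' σ) (lab ω σ)).card := by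
  rw [← Finset.card_map ⟨fun ω' : Ω₀ => (ω', σ), fun a b h => congrArg Prod.fst h⟩]
  congr 1
  ext ⟨ω', σ'⟩
  simp only [fiber, Finset.mem_filter, Finset.mem_univ, true_and, Finset.mem_map, Function.Embedding.coeFn_mk, Prod.mk.injEq]
  constructor
  · rintro ⟨h1, h2, h3⟩
    subst h2
    exact ⟨ω', ⟨h1, h3⟩, rfl, rfl⟩
  · rintro ⟨ω'', ⟨h1, h3⟩, rfl, rfl⟩
    exact ⟨h1, rfl, h3⟩

/-- **`H(W | fval(W), σ, lab(W,σ)) ≥ (log₂|Ω₀| − H(fval)) − K · Pr[¬Det]`** (`lab` is `K`-bit valued). [cite: HastadImpagliazzoLevinLuby1999, §7 (proof of Thm 7.0.5: "the conditional entropy of 𝒳 given f'(𝒳) and b(𝒳,Y) is at least cₙ − eₙ − pₙ + 1/(2n)") with Lemma 6.3.1] -/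
theorem condEntropy_ge [Nonempty Ω₀] [Nonempty Sg] (fval : Ω₀ → β) (lab : Ω₀ → Sg → γ) (K : ℕ)
    (hγ : ∀ (F : Finset Ω₀) (σ : Sg), (F.image fun ω => lab ω σ).card ≤ 2 ^ K) :
    (Real.logb 2 (Fintype.card Ω₀) - mapEntropy Finset.univ fval) -
        K * ((Finset.univ.filter fun ω : Ω₀ => ¬ Det fval ω).card : ℝ) / Fintype.card Ω₀ ≤
      mapEntropy (Finset.univ : Finset (Ω₀ × Sg)) (fun v => (v.1, (fval v.1, v.2, lab v.1 v.2))) -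
        mapEntropy (Finset.univ : Finset (Ω₀ × Sg)) (fun v => (fval v.1, v.2, lab v.1 v.2)) := by
  classical
  have hΩ₀ : (0 : ℝ) < Fintype.card Ω₀ := by exact_mod_cast Fintype.card_pos
  have hSg : (0 : ℝ) < Fintype.card Sg := by exact_mod_cast Fintype.card_pos
  have hΩ : ((Finset.univ : Finset (Ω₀ × Sg)).card : ℝ) = Fintype.card Ω₀ * Fintype.card Sg := by
    rw [Finset.card_univ, Fintype.card_prod]; push_cast; ring
  -- the joint map is injective
  have hinj : Function.Injective (fun v : Ω₀ × Sg => (v.1, (fval v.1, v.2, lab v.1 v.2))) := by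
    rintro ⟨a, b⟩ ⟨a', b'⟩ h
    simp only [Prod.mk.injEq] at h
    obtain ⟨h1, -, h2, -⟩ := h
    rw [h1, h2]
  rw [mapEntropy_of_injective hinj]
  -- `H(y) = log₂|Ω| − (Σ_v log₂|yfib v|)/|Ω|`
  have huniv : (Finset.univ : Finset (Ω₀ × Sg)).Nonempty := Finset.univ_nonempty
  have hy := sum_logb_card_fiber_eq huniv (fun v : Ω₀ × Sg => (fval v.1, v.2, lab v.1 v.2))
  rw [hΩ] at hy
  have hcardprod : (Fintype.card (Ω₀ × Sg) : ℝ) = Fintype.card Ω₀ * Fintype.card Sg := by rw [Fintype.card_prod]; push_cast; ring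
  rw [hcardprod]
  -- the sum of log class sizes
  have hsum : (Fintype.card Sg : ℝ) * (Fintype.card Ω₀ * (Real.logb 2 (Fintype.card Ω₀) - mapEntropy Finset.univ fval) -
      K * ((Finset.univ.filter fun ω : Ω₀ => ¬ Det fval ω).card : ℝ)) ≤
      ∑ v : Ω₀ × Sg, Real.logb 2 ((fiber Finset.univ (fun v : Ω₀ × Sg => (fval v.1, v.2, lab v.1 v.2)) (fval v.1, v.2, lab v.1 v.2)).card : ℝ) := by
    rw [Fintype.sum_prod_type_right]
    rw [show (Fintype.card Sg : ℝ) * _ = ∑ σ : Sg, (Fintype.card Ω₀ * (Real.logb 2 (Fintype.card Ω₀) - mapEntropy Finset.univ fval) -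
      K * ((Finset.univ.filter fun ω : Ω₀ => ¬ Det fval ω).card : ℝ)) by rw [Finset.sum_const, Finset.card_univ, nsmul_eq_mul]]
    refine Finset.sum_le_sum fun σ _ => ?_
    simp only [card_fiber_prod_eq]
    -- group by value fibres
    rw [← Finset.sum_fiberwise_of_maps_to (s := (Finset.univ : Finset Ω₀)) (t := Finset.univ.image fval) (g := fval)
      (fun ω _ => Finset.mem_image_of_mem fval (Finset.mem_univ ω))]
    have hfv : ∑ ω : Ω₀, Real.logb 2 ((fiber Finset.univ fval (fval ω)).card : ℝ) =
        Fintype.card Ω₀ * (Real.logb 2 (Fintype.card Ω₀) - mapEntropy Finset.univ fval) := by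
      rw [sum_logb_card_fiber_eq Finset.univ_nonempty fval, Finset.card_univ]
    rw [← hfv, ← Finset.sum_fiberwise_of_maps_to (s := (Finset.univ : Finset Ω₀)) (t := Finset.univ.image fval) (g := fval)
      (fun ω _ => Finset.mem_image_of_mem fval (Finset.mem_univ ω))]
    have hnot : ((Finset.univ.filter fun ω : Ω₀ => ¬ Det fval ω).card : ℝ) =
        ∑ b ∈ Finset.univ.image fval, (if (fiber Finset.univ fval b).card = 1 then (0 : ℝ) else ((fiber Finset.univ fval b).card : ℝ)) := by
      rw [Finset.card_eq_sum_card_fiberwise (f := fval) (s := Finset.univ.filter fun ω : Ω₀ => ¬ Det fval ω) (t := Finset.univ.image fval)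
        (fun ω _ => Finset.mem_image_of_mem fval (Finset.mem_univ ω))]
      push_cast
      refine Finset.sum_congr rfl fun b hb => ?_
      obtain ⟨ω₀, -, rfl⟩ := Finset.mem_image.1 hb
      by_cases h1 : (fiber Finset.univ fval (fval ω₀)).card = 1
      · rw [if_pos h1]
        have : ((Finset.univ.filter fun ω : Ω₀ => ¬ Det fval ω).filter fun ω => fval ω = fval ω₀) = ∅ := by
          rw [Finset.eq_empty_iff_forall_notMem]
          intro ω hω
          rw [Finset.mem_filter, Finset.mem_filter] at hω
          exact hω.1.2 (by unfold Det; rw [hω.2]; exact h1)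
        rw [this]; simp
      · rw [if_neg h1]
        congr 2
        ext ω
        simp only [Finset.mem_filter, Finset.mem_univ, true_and, fiber, Det]
        constructor
        · rintro ⟨-, h⟩; exact h
        · intro h; exact ⟨by rw [h]; exact h1, h⟩
    rw [hnot, Finset.mul_sum, ← Finset.sum_sub_distrib]
    refine Finset.sum_le_sum fun b hb => ?_
    obtain ⟨ω₀, -, rfl⟩ := Finset.mem_image.1 hb
    set F := fiber Finset.univ fval (fval ω₀) with hF
    have hFne : F.Nonempty := ⟨ω₀, self_mem_fiber fval (Finset.mem_univ ω₀)⟩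
    have hfil : (Finset.univ.filter fun ω : Ω₀ => fval ω = fval ω₀) = F := rfl
    rw [hfil]
    have hin : ∀ ω ∈ F, fiber Finset.univ fval (fval ω) = F := fun ω hω => by
      have e : fval ω = fval ω₀ := (Finset.mem_filter.1 hω).2
      rw [hF, e]
    rw [Finset.sum_congr rfl fun ω hω => by rw [hin ω hω], Finset.sum_const, nsmul_eq_mul,
      Finset.sum_congr rfl fun ω hω => by rw [hin ω hω]]
    exact sum_logb_class_ge F hFne (fun ω => lab ω σ) K (hγ F σ)
  -- assemble
  have hprod : (0 : ℝ) < Fintype.card Ω₀ * Fintype.card Sg := by positivity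
  have key : Real.logb 2 (Fintype.card Ω₀ * Fintype.card Sg) - mapEntropy (Finset.univ : Finset (Ω₀ × Sg)) (fun v => (fval v.1, v.2, lab v.1 v.2)) =
      (∑ v : Ω₀ × Sg, Real.logb 2 ((fiber Finset.univ (fun v : Ω₀ × Sg => (fval v.1, v.2, lab v.1 v.2)) (fval v.1, v.2, lab v.1 v.2)).card : ℝ)) /
        (Fintype.card Ω₀ * Fintype.card Sg) := by
    rw [hy]; field_simp
  rw [key, le_div_iff₀ hprod]
  have e2 : (Real.logb 2 (Fintype.card Ω₀) - mapEntropy Finset.univ fval - K * ((Finset.univ.filter fun ω : Ω₀ => ¬ Det fval ω).card : ℝ) / Fintype.card Ω₀) *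
      (Fintype.card Ω₀ * Fintype.card Sg) =
      (Fintype.card Sg : ℝ) * (Fintype.card Ω₀ * (Real.logb 2 (Fintype.card Ω₀) - mapEntropy Finset.univ fval) -
        K * ((Finset.univ.filter fun ω : Ω₀ => ¬ Det fval ω).card : ℝ)) := by
    field_simp
  rw [e2]
  exact hsum

/-- **An ignored independent uniform coordinate does not change the entropy**: `H(h ∘ fst on A × U) = H(h on A)`. [folklore] -/
theorem mapEntropy_comp_fst {A U α : Type*} [Fintype A] [Fintype U] [Nonempty A] [Nonempty U] [DecidableEq α] (h : A → α) :
    mapEntropy (Finset.univ : Finset (A × U)) (fun v => h v.1) = mapEntropy (Finset.univ : Finset A) h := by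
  classical
  have hU : (0 : ℝ) < Fintype.card U := by exact_mod_cast Fintype.card_pos
  have hA : (0 : ℝ) < Fintype.card A := by exact_mod_cast Fintype.card_pos
  have hfib : ∀ a : A, ((fiber (Finset.univ : Finset (A × U)) (fun v => h v.1) (h a)).card : ℝ) =
      (fiber (Finset.univ : Finset A) h (h a)).card * Fintype.card U := by
    intro a
    have : fiber (Finset.univ : Finset (A × U)) (fun v => h v.1) (h a) = fiber (Finset.univ : Finset A) h (h a) ×ˢ (Finset.univ : Finset U) := by
      ext ⟨a', u⟩; simp [fiber]
    rw [this, Finset.card_product, Finset.card_univ]; push_cast; ring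
  unfold mapEntropy
  rw [Finset.card_univ, Finset.card_univ, Fintype.card_prod, Fintype.sum_prod_type]
  dsimp only
  have hterm : ∀ a : A, Real.logb 2 (((Fintype.card A * Fintype.card U : ℕ) : ℝ) / ((fiber (Finset.univ : Finset (A × U)) (fun v => h v.1) (h a)).card)) =
      Real.logb 2 ((Fintype.card A : ℝ) / (fiber Finset.univ h (h a)).card) := by
    intro a
    rw [hfib a]
    congr 1
    push_cast
    field_simp
  simp only [hterm, Finset.sum_const, Finset.card_univ, nsmul_eq_mul]
  rw [← Finset.mul_sum]
  push_cast
  field_simp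

/-- **The conditional entropy of an ignored independent uniform coordinate pair**: on `A × U`,
`H((x v.1, v.2), y v.1) − H(y v.1) = (H(x, y) − H(y)) + log₂|U|`. [folklore] -/
theorem condEntropy_prod_indep {A U α β' : Type*} [Fintype A] [Fintype U] [Nonempty A] [Nonempty U] [DecidableEq α] [DecidableEq β'] [DecidableEq U]
    (x : A → α) (y : A → β') :
    mapEntropy (Finset.univ : Finset (A × U)) (fun v => ((x v.1, v.2), y v.1)) - mapEntropy (Finset.univ : Finset (A × U)) (fun v => y v.1) =
      (mapEntropy (Finset.univ : Finset A) (fun a => (x a, y a)) - mapEntropy (Finset.univ : Finset A) y) + Real.logb 2 (Fintype.card U) := by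
  classical
  have hU : (0 : ℝ) < Fintype.card U := by exact_mod_cast Fintype.card_pos
  have hA : (0 : ℝ) < Fintype.card A := by exact_mod_cast Fintype.card_pos
  rw [mapEntropy_comp_fst y]
  -- the joint map: fibres are the `A`-fibres times a point
  have hfib : ∀ a : A, ∀ u : U, ((fiber (Finset.univ : Finset (A × U)) (fun v => ((x v.1, v.2), y v.1)) ((x a, u), y a)).card : ℝ) =
      (fiber (Finset.univ : Finset A) (fun a => (x a, y a)) (x a, y a)).card := by
    intro a u
    have hset : fiber (Finset.univ : Finset (A × U)) (fun v => ((x v.1, v.2), y v.1)) ((x a, u), y a) =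
        (fiber (Finset.univ : Finset A) (fun a => (x a, y a)) (x a, y a)).map ⟨fun a' : A => (a', u), fun a b hab => congrArg Prod.fst hab⟩ := by
      ext ⟨a', u'⟩
      simp only [fiber, Finset.mem_filter, Finset.mem_univ, true_and, Finset.mem_map, Function.Embedding.coeFn_mk, Prod.mk.injEq]
      constructor
      · rintro ⟨⟨h1, h2⟩, h3⟩; exact ⟨a', ⟨h1, h3⟩, rfl, h2.symm⟩
      · rintro ⟨a'', ⟨h1, h3⟩, rfl, h2⟩; exact ⟨⟨h1, h2.symm⟩, h3⟩
    rw [hset, Finset.card_map]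
  have e1 : mapEntropy (Finset.univ : Finset (A × U)) (fun v => ((x v.1, v.2), y v.1)) =
      mapEntropy (Finset.univ : Finset A) (fun a => (x a, y a)) + Real.logb 2 (Fintype.card U) := by
    unfold mapEntropy
    rw [Finset.card_univ, Finset.card_univ, Fintype.card_prod, Fintype.sum_prod_type]
    dsimp only
    have hterm : ∀ a : A, ∀ u : U, Real.logb 2 (((Fintype.card A * Fintype.card U : ℕ) : ℝ) /
        (fiber (Finset.univ : Finset (A × U)) (fun v => ((x v.1, v.2), y v.1)) ((x a, u), y a)).card) =
        Real.logb 2 ((Fintype.card A : ℝ) / (fiber Finset.univ (fun a => (x a, y a)) (x a, y a)).card) + Real.logb 2 (Fintype.card U) := by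
      intro a u
      rw [hfib a u]
      have hf : (0 : ℝ) < (fiber Finset.univ (fun a => (x a, y a)) (x a, y a)).card := by exact_mod_cast card_fiber_pos _ (Finset.mem_univ a)
      rw [← Real.logb_mul (div_pos hA hf).ne' hU.ne']
      congr 1; push_cast; field_simp
    simp only [hterm, Finset.sum_const, Finset.card_univ, nsmul_eq_mul]
    have e2 : ∑ a : A, (Fintype.card U : ℝ) * (Real.logb 2 ((Fintype.card A : ℝ) / (fiber Finset.univ (fun a => (x a, y a)) (x a, y a)).card) + Real.logb 2 (Fintype.card U)) =
        Fintype.card U * (∑ a : A, Real.logb 2 ((Fintype.card A : ℝ) / (fiber Finset.univ (fun a => (x a, y a)) (x a, y a)).card)) +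
          Fintype.card U * Fintype.card A * Real.logb 2 (Fintype.card U) := by
      rw [Finset.mul_sum, show (Fintype.card U : ℝ) * Fintype.card A * Real.logb 2 (Fintype.card U) = ∑ a : A, (Fintype.card U : ℝ) * Real.logb 2 (Fintype.card U) by
        rw [Finset.sum_const, Finset.card_univ, nsmul_eq_mul]; ring, ← Finset.sum_add_distrib]
      refine Finset.sum_congr rfl fun a _ => by ring
    rw [e2]
    push_cast
    field_simp
  rw [e1]
  ring

end CondEnt

/-! ### Hash prefixes: counting key agreements (pairwise independence) -/

section Keys

open Complexity AffineStr

/-- **Agreement on the first `P` coordinates.** [folklore] -/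
def AgreeP (L P : ℕ) (y y' : Fin L → ZMod 2) : Prop := ∀ j : Fin L, (j : ℕ) < P → y j = y' j

/-- `AgreeP` is decidable. [folklore] -/
instance (L P : ℕ) : DecidableRel (AgreeP L P) := fun _ _ => inferInstanceAs (Decidable (∀ j : Fin L, _))

/-- The hash of `f'` as an `𝔽₂`-vector: `h_r(x) ∈ 𝔽₂^{hLen N}`. [folklore] -/
noncomputable def hv (N : ℕ) (r : List.Vector Bool (rlen N)) (x : List.Vector Bool (nLen N)) : Fin (hLen N) → ZMod 2 :=
  hashV (nLen N) (hLen N) r.toList x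

/-- `#{j : Fin L | j < P} = P` for `P ≤ L`. [folklore] -/
theorem card_filter_fin_lt {L P : ℕ} (hP : P ≤ L) : ((Finset.univ : Finset (Fin L)).filter fun j : Fin L => j.val < P).card = P := by
  have himg : (((Finset.univ : Finset (Fin L)).filter fun j : Fin L => j.val < P).image Fin.val) = Finset.range P := by
    ext i
    simp only [Finset.mem_image, Finset.mem_filter, Finset.mem_univ, true_and, Finset.mem_range]
    exact ⟨fun ⟨j, hj, e⟩ => e ▸ hj, fun hi => ⟨⟨i, lt_of_lt_of_le hi hP⟩, hi, rfl⟩⟩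
  rw [← Finset.card_image_of_injective _ Fin.val_injective, himg, Finset.card_range]

/-- **`#{y' : y' agrees with y on the first P coordinates} = 2^{L − P}`.** [folklore] -/
theorem card_filter_agree {L P : ℕ} (hP : P ≤ L) (y : Fin L → ZMod 2) :
    ((Finset.univ : Finset (Fin L → ZMod 2)).filter fun y' => AgreeP L P y y').card = 2 ^ (L - P) := by
  classical
  have hset : ((Finset.univ : Finset (Fin L → ZMod 2)).filter fun y' => AgreeP L P y y') =
      Fintype.piFinset fun j : Fin L => if j.val < P then ({y j} : Finset (ZMod 2)) else Finset.univ := by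
    ext y'
    simp only [Finset.mem_filter, Finset.mem_univ, true_and, Fintype.mem_piFinset, AgreeP]
    constructor
    · intro h j; split_ifs with hj
      · rw [Finset.mem_singleton]; exact (h j hj).symm
      · exact Finset.mem_univ _
    · intro h j hj; have := h j; rw [if_pos hj, Finset.mem_singleton] at this; exact this.symm
  rw [hset, Fintype.card_piFinset]
  have hprod : ∀ j : Fin L, ((if j.val < P then ({y j} : Finset (ZMod 2)) else Finset.univ).card) = if j.val < P then 1 else 2 := fun j => by
    split_ifs <;> simp [ZMod.card]
  simp only [hprod]
  rw [Finset.prod_ite, Finset.prod_const_one, one_mul, Finset.prod_const]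
  congr 1
  have h1 := card_filter_fin_lt hP
  have h2 := Finset.card_filter_add_card_filter_not (s := (Finset.univ : Finset (Fin L))) (fun j : Fin L => j.val < P)
  rw [Finset.card_univ, Fintype.card_fin, h1] at h2
  omega

/-- **`#{(y, y') : agreement on the first P coordinates} = 2^L · 2^{L−P}`.** [folklore] -/
theorem card_filter_agree_pairs {L P : ℕ} (hP : P ≤ L) :
    ((Finset.univ : Finset ((Fin L → ZMod 2) × (Fin L → ZMod 2))).filter fun q => AgreeP L P q.1 q.2).card = 2 ^ L * 2 ^ (L - P) := by
  classical
  rw [Finset.card_eq_sum_card_fiberwise (f := Prod.fst) (t := (Finset.univ : Finset (Fin L → ZMod 2))) (fun q _ => Finset.mem_univ _)]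
  have hfib : ∀ y : Fin L → ZMod 2, (((Finset.univ : Finset ((Fin L → ZMod 2) × (Fin L → ZMod 2))).filter fun q => AgreeP L P q.1 q.2).filter
      fun q => q.1 = y).card = 2 ^ (L - P) := by
    intro y
    rw [← card_filter_agree hP y, ← Finset.card_map ⟨fun y' : Fin L → ZMod 2 => (y, y'), fun a b h => congrArg Prod.snd h⟩]
    congr 1
    ext ⟨a, b⟩
    simp only [Finset.mem_filter, Finset.mem_univ, true_and, Finset.mem_map, Function.Embedding.coeFn_mk, Prod.mk.injEq]
    constructor
    · rintro ⟨h, rfl⟩; exact ⟨b, h, rfl, rfl⟩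
    · rintro ⟨b', h, rfl, rfl⟩; exact ⟨h, rfl⟩
  simp only [hfib, Finset.sum_const, Finset.card_univ, smul_eq_mul, Fintype.card_fun, Fintype.card_fin, ZMod.card]

/-- The keys of `f'` are pairwise independent for `h_r` (`hLen (n+1) ≤ rlen`). [folklore] -/
theorem isPairwiseIndep_hv (N : ℕ) :
    LeftoverHash.IsPairwiseIndep (Finset.univ : Finset (List.Vector Bool (rlen N))) (fun r x => hv N r x) (Finset.univ : Finset (List.Vector Bool (nLen N))) :=
  isPairwiseIndep_hashV (hLen_mul_le_rlen N) _

/-- `2·hLen N ≤ rlen N` for `N ≥ 1`. [folklore] -/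
theorem two_mul_hLen_le_rlen {N : ℕ} (hN : 1 ≤ N) : 2 * hLen N ≤ rlen N := by
  have h := hLen_le N
  unfold rlen; nlinarith

/-- **For `x ≠ x'`, exactly a `2^{−P}` fraction of the keys make `h_r(x)` and `h_r(x')` agree on the first `P ≤ hLen`
coordinates.** [cite: HastadImpagliazzoLevinLuby1999, Def. 4.4.1 (pairwise independent family) with §6.1] -/
theorem card_agree_keys {N : ℕ} (hN : 1 ≤ N) {x x' : List.Vector Bool (nLen N)} (hne : x ≠ x') {P : ℕ} (hP : P ≤ hLen N) :
    ((Finset.univ : Finset (List.Vector Bool (rlen N))).filter fun r => AgreeP (hLen N) P (hv N r x) (hv N r x')).card * 2 ^ P = 2 ^ rlen N := by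
  classical
  have hK := isPairwiseIndep_hv N x (Finset.mem_univ _) x' (Finset.mem_univ _) hne
  have hγ : Fintype.card (Fin (hLen N) → ZMod 2) = 2 ^ hLen N := by rw [Fintype.card_fun, Fintype.card_fin, ZMod.card]
  have hKc : (Finset.univ : Finset (List.Vector Bool (rlen N))).card = 2 ^ rlen N := by rw [Finset.card_univ, card_vector, Fintype.card_bool]
  -- each pair value is hit by `M₀ = 2^{rlen}/(2^{hLen})²` keys
  have hdvd : (2 ^ hLen N) ^ 2 ∣ 2 ^ rlen N := by
    rw [← pow_mul]; exact Nat.pow_dvd_pow 2 (by have := two_mul_hLen_le_rlen hN; omega)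
  set M₀ := 2 ^ rlen N / (2 ^ hLen N) ^ 2 with hM₀
  have hM₀ : M₀ * (2 ^ hLen N) ^ 2 = 2 ^ rlen N := Nat.div_mul_cancel hdvd
  have hpair : ∀ y y' : Fin (hLen N) → ZMod 2,
      ((Finset.univ : Finset (List.Vector Bool (rlen N))).filter fun r => hv N r x = y ∧ hv N r x' = y').card = M₀ := by
    intro y y'
    have h := hK y y'
    rw [hγ, hKc, ← hM₀] at h
    exact Nat.eq_of_mul_eq_mul_right (by positivity) h
  -- fibrewise over the pair value
  have hsum : ((Finset.univ : Finset (List.Vector Bool (rlen N))).filter fun r => AgreeP (hLen N) P (hv N r x) (hv N r x')).card =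
      ((Finset.univ : Finset ((Fin (hLen N) → ZMod 2) × (Fin (hLen N) → ZMod 2))).filter fun q => AgreeP (hLen N) P q.1 q.2).card * M₀ := by
    rw [Finset.card_eq_sum_card_fiberwise (f := fun r => (hv N r x, hv N r x'))
      (t := (Finset.univ : Finset ((Fin (hLen N) → ZMod 2) × (Fin (hLen N) → ZMod 2))).filter fun q => AgreeP (hLen N) P q.1 q.2)
      (fun r hr => Finset.mem_filter.2 ⟨Finset.mem_univ _, (Finset.mem_filter.1 hr).2⟩)]
    rw [Finset.sum_const_nat (m := M₀) fun q hq => ?_]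
    obtain ⟨y, y'⟩ := q
    have hq' : AgreeP (hLen N) P y y' := (Finset.mem_filter.1 hq).2
    rw [← hpair y y']
    congr 1
    ext r
    simp only [Finset.mem_filter, Finset.mem_univ, true_and, Prod.mk.injEq]
    constructor
    · rintro ⟨-, h1, h2⟩; exact ⟨h1, h2⟩
    · rintro ⟨h1, h2⟩; exact ⟨by rw [h1, h2]; exact hq', h1, h2⟩
  rw [hsum, card_filter_agree_pairs hP]
  -- arithmetic: `2^{hLen}·2^{hLen−P}·M₀·2^P = 2^{rlen}`
  have : 2 ^ hLen N * 2 ^ (hLen N - P) * M₀ * 2 ^ P = M₀ * (2 ^ hLen N) ^ 2 := by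
    rw [show (2 ^ hLen N) ^ 2 = 2 ^ hLen N * (2 ^ (hLen N - P) * 2 ^ P) by rw [← pow_add, Nat.sub_add_cancel hP, sq]]
    ring
  rw [this, hM₀]

end Keys

/-! ### `Pr[(w, r) is not determined by f'(w, r)]` -/

section DetBound

open Complexity AffineStr

variable (f : List Bool → List Bool)

/-- `f'` on the coins `(w, r)` of level `N`. [cite: HastadImpagliazzoLevinLuby1999, §6.1 eq. (3)] -/
noncomputable def fvalV (N : ℕ) (v : List.Vector Bool N × List.Vector Bool (rlen N)) : List Bool := g f (v.1.toList ++ v.2.toList)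

variable {f}

/-- Every element of `𝔽₂` is `0` or `1`. [folklore] -/
private theorem zmod2_cases (a : ZMod 2) : a = 0 ∨ a = 1 := by
  fin_cases a
  · exact Or.inl rfl
  · exact Or.inr rfl

/-- **Equal masks agree on the first `i + eLen N` hash coordinates.** [folklore] -/
theorem agree_of_maskTo_eq {N i : ℕ} {y y' : Fin (hLen N) → ZMod 2} (h : maskTo N i (encZ (hLen N) y) = maskTo N i (encZ (hLen N) y')) :
    AgreeP (hLen N) (i + eLen N) y y' := by
  have hl : ∀ z : Fin (hLen N) → ZMod 2, ((encZ (hLen N) z).take (i + eLen N)).length = min (i + eLen N) (hLen N) := fun z => by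
    rw [List.length_take, length_encZ]
  have htake : (encZ (hLen N) y).take (i + eLen N) = (encZ (hLen N) y').take (i + eLen N) := by
    unfold maskTo at h
    exact List.append_inj_left h (by rw [hl, hl])
  intro j hj
  have hjlt : (j : ℕ) < ((encZ (hLen N) y).take (i + eLen N)).length := by rw [hl]; exact lt_min hj j.isLt
  have hjlt' : (j : ℕ) < ((encZ (hLen N) y').take (i + eLen N)).length := by rw [hl]; exact lt_min hj j.isLt
  have e := List.getElem_of_eq htake hjlt
  rw [List.getElem_take, List.getElem_take] at e
  simp only [encZ, List.getElem_ofFn] at e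
  have e' : (y j = 1) ↔ (y' j = 1) := by simpa using e
  rcases zmod2_cases (y j) with h0 | h1 <;> rcases zmod2_cases (y' j) with h0' | h1'
  · rw [h0, h0']
  · exact absurd (e'.2 h1') (by rw [h0]; decide)
  · exact absurd (e'.1 h1) (by rw [h0']; decide)
  · rw [h1, h1']

/-- **The body determines its four fields** (given the lengths of `y` and `ι`). [folklore] -/
theorem body_inj {N : ℕ} {y y' M M' ib ib' ρ ρ' : List Bool} (hy : y.length = y'.length) (hM : M.length = hLen N) (hM' : M'.length = hLen N)
    (hib : ib.length = ib'.length) (h : body N y ib M ρ = body N y' ib' M' ρ') :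
    y = y' ∧ maskTo N (icap N ib) M = maskTo N (icap N ib') M' ∧ ib = ib' ∧ ρ = ρ' := by
  unfold body at h
  have hm : (maskTo N (icap N ib) M).length = (maskTo N (icap N ib') M').length := by rw [length_maskTo hM, length_maskTo hM']
  obtain ⟨h1, h4⟩ := List.append_inj h (by rw [List.length_append, List.length_append, List.length_append, List.length_append, hy, hm, hib])
  obtain ⟨h2, h3⟩ := List.append_inj h1 (by rw [List.length_append, List.length_append, hy, hm])
  obtain ⟨h5, h6⟩ := List.append_inj h2 hy
  exact ⟨h5, h6, h3, h4⟩

/-- The `x`-part of `w` as a vector. [folklore] -/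
def xv {N : ℕ} (_hN : 1 ≤ N) (w : List.Vector Bool N) : List.Vector Bool (nLen N) := ⟨xOf w.toList, by rw [length_xOf, w.toList_length]⟩

/-- **An undetermined `(w, r)` has a sibling `x' ≠ x` whose hash collides with `x`'s on the first `⟦ι⟧ + eLen N` bits.**
[cite: HastadImpagliazzoLevinLuby1999, Lemma 6.3.1 (proof: x is determined by f(x), the hash bits and i when i ≥ D̃_f(f(x)))] -/
theorem exists_sibling_of_notDet (hlp : IsLengthPreserving f) {N : ℕ} (hN : 1 ≤ N) {v : List.Vector Bool N × List.Vector Bool (rlen N)}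
    (hv : ¬ Det (fvalV f N) v) :
    ∃ x' : List.Vector Bool (nLen N), x' ≠ xv hN v.1 ∧ f x'.toList = f (xv hN v.1).toList ∧
      AgreeP (hLen N) (iOf v.1.toList + eLen N) (HILL.Ent.hv N v.2 (xv hN v.1)) (HILL.Ent.hv N v.2 x') := by
  classical
  -- a second point of the fibre
  have hmem : v ∈ fiber Finset.univ (fvalV f N) (fvalV f N v) := self_mem_fiber _ (Finset.mem_univ _)
  have hcard : 1 < (fiber Finset.univ (fvalV f N) (fvalV f N v)).card := by
    have hpos := card_fiber_pos (fvalV f N) (Finset.mem_univ v)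
    unfold Det at hv; omega
  obtain ⟨v', hv', hne⟩ := Finset.exists_mem_ne hcard v
  have heq : fvalV f N v' = fvalV f N v := (Finset.mem_filter.1 hv').2
  -- unfold both values
  obtain ⟨w, r⟩ := v
  obtain ⟨w', r'⟩ := v'
  have hw := w.toList_length
  have hw' := w'.toList_length
  simp only [fvalV] at heq
  rw [g_append hw' r'.toList_length, g_append hw r.toList_length] at heq
  have hx : (xOf w.toList).length = nLen N := by rw [length_xOf, hw]
  have hx' : (xOf w'.toList).length = nLen N := by rw [length_xOf, hw']
  have hyl : (f (xOf w'.toList)).length = (f (xOf w.toList)).length := by rw [hlp, hlp, hx, hx']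
  have hibl : (iBits w'.toList).length = (iBits w.toList).length := by rw [length_iBits, length_iBits, hw, hw']
  obtain ⟨hf, hmask, hib, hρ⟩ := body_inj (N := N) hyl (length_hashStr _ _ _ _) (length_hashStr _ _ _ _) hibl heq
  have hρ' : r' = r := List.Vector.toList_injective hρ
  -- the siblings differ
  have hxne : xOf w'.toList ≠ xOf w.toList := by
    intro hxe
    apply hne
    have : w' = w := List.Vector.toList_injective (by rw [← xOf_append_iBits w'.toList, ← xOf_append_iBits w.toList, hxe, hib])
    rw [this, hρ']
  refine ⟨⟨xOf w'.toList, hx'⟩, fun h => hxne (congrArg List.Vector.toList h), hf, ?_⟩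
  -- the masks: `icap` of the common index block is `⟦ι⟧`
  have hic : icap N (iBits w.toList) = iOf w.toList := by
    rw [iOf]; exact icap_eq (by rw [length_iBits, hw]; exact ibLen_le_bLen N)
  rw [hib, hic] at hmask
  have hm : maskTo N (iOf w.toList) (encZ (hLen N) (HILL.Ent.hv N r (xv hN w))) = maskTo N (iOf w.toList) (encZ (hLen N) (HILL.Ent.hv N r ⟨xOf w'.toList, hx'⟩)) := by
    rw [HILL.Ent.hv, HILL.Ent.hv, ← hashStr_toList, ← hashStr_toList]
    rw [hρ'] at hmask
    exact hmask.symm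
  exact agree_of_maskTo_eq hm

/-- **The layer `⟦ι⟧ = D̃`**: `#{w : ⟦ι⟧ < D̃_f(f x)} + 2^{n(N)} ≤ #𝒯₀` (`N ≥ 1`). [cite: HastadImpagliazzoLevinLuby1999, §6.3 (the layer i = D̃_f(f(x)))] -/
theorem card_iOf_lt_Dtil_add_le {N : ℕ} (hN1 : 1 ≤ N) :
    ((Finset.univ : Finset (List.Vector Bool N)).filter fun w => iOf w.toList < Dtil f (xOf w.toList)).card + 2 ^ nLen N ≤ (T f 0 N).card := by
  classical
  set low := (Finset.univ : Finset (List.Vector Bool N)).filter fun w => iOf w.toList < Dtil f (xOf w.toList) with hlow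
  set layer := (Finset.univ : Finset (List.Vector Bool N)).filter fun w => iOf w.toList = Dtil f (xOf w.toList) with hlayer
  have hdisj : Disjoint low layer := by
    rw [Finset.disjoint_left]
    intro w hw hw'
    rw [hlow, Finset.mem_filter] at hw
    rw [hlayer, Finset.mem_filter] at hw'
    omega
  have hsub : low ∪ layer ⊆ T f 0 N := by
    intro w hw
    rw [Finset.mem_union, hlow, hlayer, Finset.mem_filter, Finset.mem_filter] at hw
    rw [mem_T]
    rcases hw with hw | hw <;> omega
  have hlt : ∀ x : List.Vector Bool (nLen N), Dtil f x.toList < 2 ^ bLen N := fun x => by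
    have h1 := Dtil_le f x.toList
    have h2 := lt_two_pow_bLen N
    have h3 := nLen_add_bLen hN1
    rw [x.toList_length] at h1
    omega
  have hlen : ∀ x : List.Vector Bool (nLen N), (x.toList ++ Complexity.natBits (bLen N) (Dtil f x.toList)).length = N := fun x => by
    rw [List.length_append, x.toList_length, Complexity.length_natBits, nLen_add_bLen hN1]
  let ι : List.Vector Bool (nLen N) → List.Vector Bool N := fun x => ⟨x.toList ++ Complexity.natBits (bLen N) (Dtil f x.toList), hlen x⟩
  have hinj : Function.Injective ι := fun x x' h => by
    have h' := congrArg List.Vector.toList h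
    exact List.Vector.toList_injective (List.append_inj_left h' (by rw [x.toList_length, x'.toList_length]))
  have hmem : ∀ x, ι x ∈ layer := fun x => by
    rw [hlayer, Finset.mem_filter]
    refine ⟨Finset.mem_univ _, ?_⟩
    have hib : (Complexity.natBits (bLen N) (Dtil f x.toList)).length = ibLen N := by rw [Complexity.length_natBits, ibLen_eq hN1]
    show iOf (x.toList ++ Complexity.natBits (bLen N) (Dtil f x.toList)) = Dtil f (xOf (x.toList ++ Complexity.natBits (bLen N) (Dtil f x.toList)))
    rw [iOf, iBits_append x.toList_length hib, xOf_append x.toList_length hib, Complexity.bitsToNat_natBits (hlt x)]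
  have hcard : 2 ^ nLen N ≤ layer.card :=
    calc 2 ^ nLen N = (Finset.univ : Finset (List.Vector Bool (nLen N))).card := by rw [Finset.card_univ, card_vector, Fintype.card_bool]
      _ = ((Finset.univ : Finset (List.Vector Bool (nLen N))).image ι).card := (Finset.card_image_of_injective _ hinj).symm
      _ ≤ layer.card := Finset.card_le_card fun w hw => by
          obtain ⟨x, _, rfl⟩ := Finset.mem_image.1 hw
          exact hmem x
  calc low.card + 2 ^ nLen N ≤ low.card + layer.card := Nat.add_le_add_left hcard _
    _ = (low ∪ layer).card := (Finset.card_union_of_disjoint hdisj).symm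
    _ ≤ (T f 0 N).card := Finset.card_le_card hsub

/-- `#Sy < 2^{D̃ + 1}`. [folklore] -/
theorem card_Sy_lt {n : ℕ} (x₀ : List.Vector Bool n) : (Sy f n (f x₀.toList)).card < 2 ^ (Dtil f x₀.toList + 1) := by
  rw [card_Sy_eq, Dtil, x₀.toList_length]
  exact Nat.lt_pow_succ_log_self one_lt_two _

/-- Agreement beyond the length is agreement everywhere. [folklore] -/
theorem agreeP_iff_min {L P : ℕ} (y y' : Fin L → ZMod 2) : AgreeP L P y y' ↔ AgreeP L (min P L) y y' :=
  ⟨fun h j hj => h j (lt_of_lt_of_le hj (min_le_left _ _)), fun h j hj => h j (lt_min hj j.isLt)⟩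

/-- **`Pr[(w, r) not determined by f'(w, r)] ≤ Pr[⟦ι⟧ < D̃] + 2^{1 − eLen N}`** (counting form). [cite: HastadImpagliazzoLevinLuby1999, Lemma 6.3.1 (proof: "b is almost totally predictable for almost all inputs where I ≥ D̃_f(f(X))")] -/
theorem card_notDet_le (hlp : IsLengthPreserving f) {N : ℕ} (hN : 1 ≤ N) :
    ((Finset.univ : Finset (List.Vector Bool N × List.Vector Bool (rlen N))).filter fun v => ¬ Det (fvalV f N) v).card * 2 ^ eLen N ≤
      ((Finset.univ : Finset (List.Vector Bool N)).filter fun w => iOf w.toList < Dtil f (xOf w.toList)).card * 2 ^ rlen N * 2 ^ eLen N +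
        2 ^ N * (2 * 2 ^ rlen N) := by
  classical
  -- the two parts
  set A : Finset (List.Vector Bool N × List.Vector Bool (rlen N)) := Finset.univ.filter fun v => iOf v.1.toList < Dtil f (xOf v.1.toList) with hA
  set Wg : Finset (List.Vector Bool N) := Finset.univ.filter fun w => Dtil f (xOf w.toList) ≤ iOf w.toList with hWg
  set C : List.Vector Bool N → Finset (List.Vector Bool (rlen N)) := fun w =>
    ((Sy f (nLen N) (f (xv hN w).toList)).erase (xv hN w)).biUnion fun x' =>
      Finset.univ.filter fun r => AgreeP (hLen N) (iOf w.toList + eLen N) (HILL.Ent.hv N r (xv hN w)) (HILL.Ent.hv N r x') with hC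
  set B : Finset (List.Vector Bool N × List.Vector Bool (rlen N)) := Wg.biUnion fun w => ({w} : Finset _) ×ˢ C w with hB
  have hcover : (Finset.univ.filter fun v : List.Vector Bool N × List.Vector Bool (rlen N) => ¬ Det (fvalV f N) v) ⊆ A ∪ B := by
    intro v hv
    rw [Finset.mem_union]
    by_cases hlt : iOf v.1.toList < Dtil f (xOf v.1.toList)
    · exact Or.inl (Finset.mem_filter.2 ⟨Finset.mem_univ _, hlt⟩)
    · right
      obtain ⟨x', hx'ne, hfx', hagree⟩ := exists_sibling_of_notDet hlp hN (Finset.mem_filter.1 hv).2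
      rw [hB, Finset.mem_biUnion]
      refine ⟨v.1, Finset.mem_filter.2 ⟨Finset.mem_univ _, not_lt.1 hlt⟩, Finset.mem_product.2 ⟨Finset.mem_singleton_self _, ?_⟩⟩
      rw [hC, Finset.mem_biUnion]
      exact ⟨x', Finset.mem_erase.2 ⟨hx'ne, by simp [Sy, hfx']⟩, Finset.mem_filter.2 ⟨Finset.mem_univ _, hagree⟩⟩
  -- `#A = #{w : ⟦ι⟧ < D̃} · 2^{rlen}`
  have hAc : A.card = ((Finset.univ : Finset (List.Vector Bool N)).filter fun w => iOf w.toList < Dtil f (xOf w.toList)).card * 2 ^ rlen N := by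
    have : A = ((Finset.univ : Finset (List.Vector Bool N)).filter fun w => iOf w.toList < Dtil f (xOf w.toList)) ×ˢ (Finset.univ : Finset (List.Vector Bool (rlen N))) := by
      ext ⟨w, r⟩; simp [hA]
    rw [this, Finset.card_product, Finset.card_univ, card_vector, Fintype.card_bool]
  -- `#C w · 2^{eLen} ≤ 2 · 2^{rlen}` on `Wg`
  have hCc : ∀ w ∈ Wg, (C w).card * 2 ^ eLen N ≤ 2 * 2 ^ rlen N := by
    intro w hw
    have hdw : Dtil f (xOf w.toList) ≤ iOf w.toList := (Finset.mem_filter.1 hw).2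
    set P' := min (iOf w.toList + eLen N) (hLen N) with hP'
    have hP'le : P' ≤ hLen N := min_le_right _ _
    have hDn : Dtil f (xv hN w).toList ≤ nLen N := by have := Dtil_le f (xv hN w).toList; rwa [(xv hN w).toList_length] at this
    have hxvl : (xv hN w).toList = xOf w.toList := rfl
    have hP'ge : Dtil f (xv hN w).toList + eLen N ≤ P' := by
      rw [hP', hxvl]; unfold hLen; rw [hxvl] at hDn; omega
    -- each sibling contributes `2^{rlen}/2^{P'}` keys
    have hterm : ∀ x' ∈ (Sy f (nLen N) (f (xv hN w).toList)).erase (xv hN w),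
        (Finset.univ.filter fun r => AgreeP (hLen N) (iOf w.toList + eLen N) (HILL.Ent.hv N r (xv hN w)) (HILL.Ent.hv N r x')).card * 2 ^ P' = 2 ^ rlen N := by
      intro x' hx'
      have hne : xv hN w ≠ x' := fun h => (Finset.mem_erase.1 hx').1 h.symm
      rw [← card_agree_keys hN hne hP'le]
      congr 2
      ext r
      simp only [Finset.mem_filter, Finset.mem_univ, true_and]
      exact agreeP_iff_min _ _
    have hsum : (C w).card * 2 ^ P' ≤ ((Sy f (nLen N) (f (xv hN w).toList)).card - 1) * 2 ^ rlen N := by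
      rw [hC]
      refine (Nat.mul_le_mul_right _ Finset.card_biUnion_le).trans ?_
      rw [Finset.sum_mul, Finset.sum_congr rfl fun x' hx' => hterm x' hx', Finset.sum_const, smul_eq_mul,
        Finset.card_erase_of_mem (mem_Sy_self (f := f) (xv hN w))]
    -- `(#Sy − 1) · 2^{eLen} ≤ 2 · 2^{P'}`
    have hSy := card_Sy_lt (f := f) (xv hN w)
    have hkey : ((Sy f (nLen N) (f (xv hN w).toList)).card - 1) * 2 ^ eLen N ≤ 2 * 2 ^ P' := by
      have h1 : (Sy f (nLen N) (f (xv hN w).toList)).card - 1 < 2 ^ (Dtil f (xv hN w).toList + 1) := by omega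
      calc ((Sy f (nLen N) (f (xv hN w).toList)).card - 1) * 2 ^ eLen N ≤ 2 ^ (Dtil f (xv hN w).toList + 1) * 2 ^ eLen N :=
            Nat.mul_le_mul_right _ h1.le
        _ = 2 * 2 ^ (Dtil f (xv hN w).toList + eLen N) := by rw [pow_succ, pow_add]; ring
        _ ≤ 2 * 2 ^ P' := Nat.mul_le_mul_left _ (Nat.pow_le_pow_right (by norm_num) hP'ge)
    have hpos : 0 < 2 ^ P' := Nat.two_pow_pos _
    refine Nat.le_of_mul_le_mul_right ?_ hpos
    calc (C w).card * 2 ^ eLen N * 2 ^ P' = (C w).card * 2 ^ P' * 2 ^ eLen N := by ring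
      _ ≤ ((Sy f (nLen N) (f (xv hN w).toList)).card - 1) * 2 ^ rlen N * 2 ^ eLen N := Nat.mul_le_mul_right _ hsum
      _ = ((Sy f (nLen N) (f (xv hN w).toList)).card - 1) * 2 ^ eLen N * 2 ^ rlen N := by ring
      _ ≤ 2 * 2 ^ P' * 2 ^ rlen N := Nat.mul_le_mul_right _ hkey
      _ = 2 * 2 ^ rlen N * 2 ^ P' := by ring
  -- `#B · 2^{eLen} ≤ 2^N · 2 · 2^{rlen}`
  have hBc : B.card * 2 ^ eLen N ≤ 2 ^ N * (2 * 2 ^ rlen N) := by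
    rw [hB]
    refine (Nat.mul_le_mul_right _ Finset.card_biUnion_le).trans ?_
    rw [Finset.sum_mul]
    calc ∑ w ∈ Wg, (({w} : Finset _) ×ˢ C w).card * 2 ^ eLen N ≤ ∑ w ∈ Wg, 2 * 2 ^ rlen N :=
          Finset.sum_le_sum fun w hw => by rw [Finset.card_product, Finset.card_singleton, one_mul]; exact hCc w hw
      _ = Wg.card * (2 * 2 ^ rlen N) := by rw [Finset.sum_const, smul_eq_mul]
      _ ≤ 2 ^ N * (2 * 2 ^ rlen N) := Nat.mul_le_mul_right _ (by
          calc Wg.card ≤ (Finset.univ : Finset (List.Vector Bool N)).card := Finset.card_le_univ _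
            _ = 2 ^ N := by rw [Finset.card_univ, card_vector, Fintype.card_bool])
  calc (Finset.univ.filter fun v : List.Vector Bool N × List.Vector Bool (rlen N) => ¬ Det (fvalV f N) v).card * 2 ^ eLen N
      ≤ (A ∪ B).card * 2 ^ eLen N := Nat.mul_le_mul_right _ (Finset.card_le_card hcover)
    _ ≤ (A.card + B.card) * 2 ^ eLen N := Nat.mul_le_mul_right _ (Finset.card_union_le _ _)
    _ = A.card * 2 ^ eLen N + B.card * 2 ^ eLen N := by ring
    _ ≤ _ := by rw [hAc]; exact Nat.add_le_add_left hBc _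

/-- **`Pr[¬Det] ≤ p₀ − 2^{−b(N)} + 2^{1−eLen N}`** with `p₀ = #𝒯₀/2^N` (`N ≥ 1`). [cite: HastadImpagliazzoLevinLuby1999, Lemma 6.3.1 (proof)] -/
theorem prob_notDet_le (hlp : IsLengthPreserving f) {N : ℕ} (hN : 1 ≤ N) :
    (((Finset.univ : Finset (List.Vector Bool N × List.Vector Bool (rlen N))).filter fun v => ¬ Det (fvalV f N) v).card : ℝ) /
        Fintype.card (List.Vector Bool N × List.Vector Bool (rlen N)) ≤
      ((T f 0 N).card : ℝ) / 2 ^ N - 1 / 2 ^ bLen N + 2 / 2 ^ eLen N := by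
  have h1 := card_notDet_le hlp hN
  have h2 := card_iOf_lt_Dtil_add_le (f := f) hN
  have hnb := nLen_add_bLen hN
  have hΩ : (Fintype.card (List.Vector Bool N × List.Vector Bool (rlen N)) : ℝ) = 2 ^ N * 2 ^ rlen N := by
    rw [Fintype.card_prod, card_vector, card_vector, Fintype.card_bool]; push_cast; ring
  rw [hΩ]
  have hpow : (2 : ℝ) ^ N = 2 ^ nLen N * 2 ^ bLen N := by rw [← pow_add, hnb]
  -- real arithmetic
  have h1r : (((Finset.univ : Finset (List.Vector Bool N × List.Vector Bool (rlen N))).filter fun v => ¬ Det (fvalV f N) v).card : ℝ) * 2 ^ eLen N ≤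
      (((Finset.univ : Finset (List.Vector Bool N)).filter fun w => iOf w.toList < Dtil f (xOf w.toList)).card : ℝ) * 2 ^ rlen N * 2 ^ eLen N +
        2 ^ N * (2 * 2 ^ rlen N) := by exact_mod_cast h1
  have h2r : (((Finset.univ : Finset (List.Vector Bool N)).filter fun w => iOf w.toList < Dtil f (xOf w.toList)).card : ℝ) + 2 ^ nLen N ≤ (T f 0 N).card := by
    exact_mod_cast h2
  have hE : (0 : ℝ) < 2 ^ eLen N := by positivity
  have hR : (0 : ℝ) < 2 ^ rlen N := by positivity
  have hNp : (0 : ℝ) < 2 ^ N := by positivity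
  have hb : (0 : ℝ) < 2 ^ bLen N := by positivity
  rw [div_le_iff₀ (by positivity)]
  have hrhs : (((T f 0 N).card : ℝ) / 2 ^ N - 1 / 2 ^ bLen N + 2 / 2 ^ eLen N) * (2 ^ N * 2 ^ rlen N) =
      ((T f 0 N).card - 2 ^ nLen N) * 2 ^ rlen N + 2 ^ N * (2 * 2 ^ rlen N) / 2 ^ eLen N := by
    rw [hpow]; field_simp
  rw [hrhs]
  have h3 : (((Finset.univ : Finset (List.Vector Bool N × List.Vector Bool (rlen N))).filter fun v => ¬ Det (fvalV f N) v).card : ℝ) ≤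
      (((Finset.univ : Finset (List.Vector Bool N)).filter fun w => iOf w.toList < Dtil f (xOf w.toList)).card : ℝ) * 2 ^ rlen N +
        2 ^ N * (2 * 2 ^ rlen N) / 2 ^ eLen N := by
    have := div_le_div_of_nonneg_right h1r hE.le
    rwa [mul_div_cancel_right₀ _ hE.ne', show ((((Finset.univ : Finset (List.Vector Bool N)).filter fun w => iOf w.toList < Dtil f (xOf w.toList)).card : ℝ) *
      2 ^ rlen N * 2 ^ eLen N + 2 ^ N * (2 * 2 ^ rlen N)) / 2 ^ eLen N =
      (((Finset.univ : Finset (List.Vector Bool N)).filter fun w => iOf w.toList < Dtil f (xOf w.toList)).card : ℝ) * 2 ^ rlen N +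
        2 ^ N * (2 * 2 ^ rlen N) / 2 ^ eLen N by field_simp] at this
  nlinarith [h3, h2r, hR.le, mul_le_mul_of_nonneg_right h2r hR.le]

end DetBound

end Ent

end HILL

end Literature.Computability.Cryptography
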